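import Mathlib
import Literature.MathematicalPhysics.QuantumLattice.FermiRG.Salmhofer1998Sec5PropagatorLemmas
import HarnessLib

/-!
# Salmhofer 1998, Lemma 5 — toolkit I: the kernel `𝒞̇_t` as a scaled smooth compactly supported
# profile, slice derivatives of all orders, second differences

M. Salmhofer, *Continuous renormalization for fermions and Fermi liquid theory*, Commun. Math. Phys.
**194** (1998) 249–295 = arXiv:cond-mat/9706188 [Salmhofer1998], §5.5, proof of Lemma 5 (render
`paper:arxiv-cond-mat_9706188` p.20 L66–104; locators `p.N Ln` = chunk `pNNNN.txt` line `n`).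

Theorem-only-in-spirit companion (two proof-device `def`s, no named fact, net debt `0`) of the FROZEN
statement file `Salmhofer1998Sec5.lean` (licence F-086 `DotCovarianceL1Bound`).  The printed proof uses
"a Taylor expansion of `𝒞̇_t(x,y)` to order `q` in `x`" and that "`Δ^q 𝒞̇_t` is still `C^{k₀}` in `𝐤`" with
`|∂^α Δ^q 𝒞̇_t| ≤ N₁ β^{-q} ε_t^{-1-|α|-q}` (p.20 L99–104).  Here this is organised as follows:

* `cutoffExt χ₁` is a GLOBAL `C^∞` modification of the cutoff `χ₁` (equal to `χ₁` on `[0,∞)`, to `1` on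
  `(-∞, 1/8]`), so that the profile `kerProfile χ₁ (u,v) = -2(iu + v) χ₁'(u² + v²)` is a smooth, compactly
  supported function on `ℝ × ℝ` with `𝒞̇_t(x,y) = ε_t⁻¹ · kerProfile(x/ε_t, y/ε_t)` (`covCDot_eq_kerProfile`;
  the printed formula is `covCDot_eq` of the companion `Salmhofer1998Sec5PropagatorLemmas`).
* For ANY smooth compactly supported `Θ : ℝ × ℝ → ℂ`: the slices `v ↦ Θ(u,v)` / `u ↦ Θ(u,v)` are smooth,
  their iterated derivatives are the iterated Fréchet derivatives of `Θ` evaluated on a constant frame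
  (`iteratedDeriv_slice_snd/fst`), hence bounded uniformly (`exists_bound_slice_snd/fst`), and vanish
  where `Θ` vanishes identically nearby; the evaluated iterated derivative `p ↦ D^nΘ(p)[e,…,e]` is again
  such a profile (`contDiff_iteratedFDeriv_apply`, `hasCompactSupport_iteratedFDeriv_apply`) — this is the
  recursion behind "still `C^{k₀}`".
* Scaling `y ↦ ε⁻¹Θ(x/ε, y/ε)`: `n`-th derivative `= ε^{-1-n} (∂₂ⁿΘ)(x/ε, y/ε)` (`iteratedDeriv_scaledSlice`),
  hence `≤ C_n ε^{-1-n}` — the `ε_t^{-1-|α|}` law of (5.18)/(5.25).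
* Second differences: `‖ψ(x) - 2ψ(x-a) + ψ(x-2a)‖ ≤ a² sup‖ψ''‖` by the mean value inequality twice
  (`norm_secondDiff_le`) — the "Taylor expansion to order `q = 2` in `x`" producing `β^{-2} = (a/2π)²`.

No `instance`, no `notation`, no sorry/axiom; nothing about the Hubbard model is asserted or denied.
-/

noncomputable section

open Filter Function
open scoped Topology ContDiff

namespace Literature.MathematicalPhysics.QuantumLattice.FermiRG

namespace Salmhofer1998

/-! ### Smooth compactly supported profiles on `ℝ × ℝ` -/

section Profile

variable {Θ : ℝ × ℝ → ℂ}

/-- All Fréchet derivatives of a smooth compactly supported profile are bounded.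
[cite: Salmhofer1998, Lemma 5 proof (p.20 L99–104)] -/
theorem exists_bound_iteratedFDeriv (hΘ : ContDiff ℝ ∞ Θ) (hc : HasCompactSupport Θ) (n : ℕ) :
    ∃ C : ℝ, 0 ≤ C ∧ ∀ p : ℝ × ℝ, ‖iteratedFDeriv ℝ n Θ p‖ ≤ C := by
  have hcont : Continuous (iteratedFDeriv ℝ n Θ) :=
    hΘ.continuous_iteratedFDeriv (mod_cast le_top)
  obtain ⟨C, hC⟩ := hcont.bounded_above_of_compact_support (hc.iteratedFDeriv n)
  exact ⟨max C 0, le_max_right _ _, fun p => (hC p).trans (le_max_left _ _)⟩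

/-- The slice `v ↦ Θ(u, v)` is the composition of a translate of `Θ` with the inclusion `inr`.
[cite: Salmhofer1998, Lemma 5 proof (p.20 L99–104)] -/
theorem slice_snd_eq (u : ℝ) :
    (fun v : ℝ => Θ (u, v)) = (fun z : ℝ × ℝ => Θ (((u, 0) : ℝ × ℝ) + z)) ∘
      (ContinuousLinearMap.inr ℝ ℝ ℝ) := by
  funext v
  simp

/-- The slice `u ↦ Θ(u, v)` is the composition of a translate of `Θ` with the inclusion `inl`.
[cite: Salmhofer1998, Lemma 5 proof (p.20 L99–104)] -/
theorem slice_fst_eq (v : ℝ) :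
    (fun u : ℝ => Θ (u, v)) = (fun z : ℝ × ℝ => Θ (((0, v) : ℝ × ℝ) + z)) ∘
      (ContinuousLinearMap.inl ℝ ℝ ℝ) := by
  funext u
  simp

/-- The slice `v ↦ Θ(u,v)` of a smooth profile is smooth. [cite: Salmhofer1998, Lemma 5 proof (p.20 L99–104)] -/
theorem contDiff_slice_snd (hΘ : ContDiff ℝ ∞ Θ) (u : ℝ) : ContDiff ℝ ∞ fun v : ℝ => Θ (u, v) :=
  hΘ.comp (contDiff_const.prodMk contDiff_id)

/-- The slice `u ↦ Θ(u,v)` of a smooth profile is smooth. [cite: Salmhofer1998, Lemma 5 proof (p.20 L99–104)] -/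
theorem contDiff_slice_fst (hΘ : ContDiff ℝ ∞ Θ) (v : ℝ) : ContDiff ℝ ∞ fun u : ℝ => Θ (u, v) :=
  hΘ.comp (contDiff_id.prodMk contDiff_const)

/-- The `n`-th derivative of the slice `v ↦ Θ(u,v)` is `DⁿΘ(u,w)[(0,1),…,(0,1)]`.
[cite: Salmhofer1998, Lemma 5 proof (p.20 L99–104)] -/
theorem iteratedDeriv_slice_snd (hΘ : ContDiff ℝ ∞ Θ) (n : ℕ) (u w : ℝ) :
    iteratedDeriv n (fun v : ℝ => Θ (u, v)) w =
      iteratedFDeriv ℝ n Θ (u, w) (fun _ => ((0 : ℝ), (1 : ℝ))) := by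
  have htr : ContDiff ℝ ∞ (fun z : ℝ × ℝ => Θ (((u, 0) : ℝ × ℝ) + z)) :=
    hΘ.comp (contDiff_const.add contDiff_id)
  rw [iteratedDeriv_eq_iteratedFDeriv, slice_snd_eq,
    ContinuousLinearMap.iteratedFDeriv_comp_right _ htr _ (mod_cast le_top),
    ContinuousMultilinearMap.compContinuousLinearMap_apply, iteratedFDeriv_comp_add_left]
  simp

/-- The `n`-th derivative of the slice `u ↦ Θ(u,v)` is `DⁿΘ(w,v)[(1,0),…,(1,0)]`.
[cite: Salmhofer1998, Lemma 5 proof (p.20 L99–104)] -/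
theorem iteratedDeriv_slice_fst (hΘ : ContDiff ℝ ∞ Θ) (n : ℕ) (v w : ℝ) :
    iteratedDeriv n (fun u : ℝ => Θ (u, v)) w =
      iteratedFDeriv ℝ n Θ (w, v) (fun _ => ((1 : ℝ), (0 : ℝ))) := by
  have htr : ContDiff ℝ ∞ (fun z : ℝ × ℝ => Θ (((0, v) : ℝ × ℝ) + z)) :=
    hΘ.comp (contDiff_const.add contDiff_id)
  rw [iteratedDeriv_eq_iteratedFDeriv, slice_fst_eq,
    ContinuousLinearMap.iteratedFDeriv_comp_right _ htr _ (mod_cast le_top),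
    ContinuousMultilinearMap.compContinuousLinearMap_apply, iteratedFDeriv_comp_add_left]
  simp

/-- Evaluating an `n`-linear map on a frame of unit vectors does not increase the norm.
[cite: Salmhofer1998, Lemma 5 proof (p.20 L99–104)] -/
theorem norm_apply_const_le {n : ℕ} (A : ContinuousMultilinearMap ℝ (fun _ : Fin n => ℝ × ℝ) ℂ)
    (e : ℝ × ℝ) (he : ‖e‖ ≤ 1) : ‖A (fun _ => e)‖ ≤ ‖A‖ := by
  refine (A.le_opNorm _).trans ?_
  have h1 : ∏ _i : Fin n, ‖e‖ ≤ 1 := Finset.prod_le_one (fun _ _ => norm_nonneg _) fun _ _ => he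
  calc ‖A‖ * ∏ _i : Fin n, ‖e‖ ≤ ‖A‖ * 1 := by gcongr
    _ = ‖A‖ := mul_one _

/-- Uniform bound on all `v`-derivatives of the slices `v ↦ Θ(u,v)`, uniformly in `u`.
[cite: Salmhofer1998, Lemma 5 proof (p.20 L99–104)] -/
theorem exists_bound_slice_snd (hΘ : ContDiff ℝ ∞ Θ) (hc : HasCompactSupport Θ) (n : ℕ) :
    ∃ C : ℝ, 0 ≤ C ∧ ∀ u w : ℝ, ‖iteratedDeriv n (fun v : ℝ => Θ (u, v)) w‖ ≤ C := by
  obtain ⟨C, hC0, hC⟩ := exists_bound_iteratedFDeriv hΘ hc n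
  refine ⟨C, hC0, fun u w => ?_⟩
  rw [iteratedDeriv_slice_snd hΘ]
  exact (norm_apply_const_le _ _ (by simp [Prod.norm_def])).trans (hC _)

/-- Uniform bound on all `u`-derivatives of the slices `u ↦ Θ(u,v)`, uniformly in `v`.
[cite: Salmhofer1998, Lemma 5 proof (p.20 L99–104)] -/
theorem exists_bound_slice_fst (hΘ : ContDiff ℝ ∞ Θ) (hc : HasCompactSupport Θ) (n : ℕ) :
    ∃ C : ℝ, 0 ≤ C ∧ ∀ v w : ℝ, ‖iteratedDeriv n (fun u : ℝ => Θ (u, v)) w‖ ≤ C := by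
  obtain ⟨C, hC0, hC⟩ := exists_bound_iteratedFDeriv hΘ hc n
  refine ⟨C, hC0, fun v w => ?_⟩
  rw [iteratedDeriv_slice_fst hΘ]
  exact (norm_apply_const_le _ _ (by simp [Prod.norm_def])).trans (hC _)

/-- `DⁿΘ` vanishes outside the topological support of `Θ`. [cite: Salmhofer1998, Lemma 5 proof (p.20 L99–104)] -/
theorem iteratedFDeriv_eq_zero_of_notMem_tsupport (n : ℕ) {p : ℝ × ℝ} (hp : p ∉ tsupport Θ) :
    iteratedFDeriv ℝ n Θ p = 0 := by
  by_contra h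
  exact hp (support_iteratedFDeriv_subset n h)

/-- The evaluated iterated derivative `p ↦ DⁿΘ(p)[M]` of a smooth profile is smooth.
[cite: Salmhofer1998, Lemma 5 proof (p.20 L99–104)] -/
theorem contDiff_iteratedFDeriv_apply (hΘ : ContDiff ℝ ∞ Θ) (n : ℕ) (M : Fin n → ℝ × ℝ) :
    ContDiff ℝ ∞ fun p : ℝ × ℝ => iteratedFDeriv ℝ n Θ p M := by
  have h1 : ContDiff ℝ ∞ (iteratedFDeriv ℝ n Θ) := by
    rw [contDiff_infty]
    intro m
    exact hΘ.iteratedFDeriv_right (by exact_mod_cast le_top)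
  have h2 : ContDiff ℝ ∞ (fun A : ContinuousMultilinearMap ℝ (fun _ : Fin n => ℝ × ℝ) ℂ => A M) :=
    (ContinuousMultilinearMap.apply ℝ (fun _ : Fin n => ℝ × ℝ) ℂ M).contDiff
  exact h2.comp h1

/-- The evaluated iterated derivative `p ↦ DⁿΘ(p)[M]` of a compactly supported profile is compactly
supported. [cite: Salmhofer1998, Lemma 5 proof (p.20 L99–104)] -/
theorem hasCompactSupport_iteratedFDeriv_apply (hc : HasCompactSupport Θ) (n : ℕ)
    (M : Fin n → ℝ × ℝ) : HasCompactSupport fun p : ℝ × ℝ => iteratedFDeriv ℝ n Θ p M := by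
  refine (hc.iteratedFDeriv (𝕜 := ℝ) n).mono ?_
  intro p hp
  simp only [mem_support, ne_eq] at hp ⊢
  intro h
  exact hp (by simp [h])

/-- The topological support of `p ↦ DⁿΘ(p)[M]` lies in that of `Θ`. [cite: Salmhofer1998, Lemma 5 proof (p.20 L99–104)] -/
theorem tsupport_iteratedFDeriv_apply_subset (n : ℕ) (M : Fin n → ℝ × ℝ) :
    tsupport (fun p : ℝ × ℝ => iteratedFDeriv ℝ n Θ p M) ⊆ tsupport Θ := by
  have h1 : tsupport (fun p : ℝ × ℝ => iteratedFDeriv ℝ n Θ p M) ⊆ tsupport (iteratedFDeriv ℝ n Θ) :=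
    tsupport_comp_subset (g := fun A : ContinuousMultilinearMap ℝ (fun _ : Fin n => ℝ × ℝ) ℂ => A M)
      (by simp) (iteratedFDeriv ℝ n Θ)
  exact h1.trans (tsupport_iteratedFDeriv_subset n)

/-! ### Scaling: `y ↦ ε⁻¹ Θ(x/ε, y/ε)` -/

/-- **The `ε^{-1-n}` law**: the `n`-th `y`-derivative of `y ↦ ε⁻¹Θ(x/ε, y/ε)` is
`ε^{-1-n} (∂₂ⁿΘ)(x/ε, y/ε)` (the scaling behind `B_α ε_t^{-1-|α|}` in (5.18) and `N₁ ε_t^{-1-|α|-q}` in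
(5.25)). [cite: Salmhofer1998, Lemma 4 (5.18) (p.19 L138–141); Lemma 5 proof (5.25) (p.20 L99–104)] -/
theorem iteratedDeriv_scaledSlice (hΘ : ContDiff ℝ ∞ Θ) (ε x : ℝ) (n : ℕ) (w : ℝ) :
    iteratedDeriv n (fun y : ℝ => ((ε⁻¹ : ℝ) : ℂ) * Θ (x / ε, y / ε)) w =
      ((ε⁻¹ : ℝ) : ℂ) * (((ε⁻¹) ^ n : ℝ) : ℂ) * iteratedDeriv n (fun v : ℝ => Θ (x / ε, v)) (w / ε) := by
  have hsl : ContDiff ℝ n (fun v : ℝ => Θ (x / ε, v)) := (contDiff_slice_snd hΘ _).of_le (mod_cast le_top)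
  have hcomp : (fun y : ℝ => Θ (x / ε, y / ε)) = fun y : ℝ => (fun v : ℝ => Θ (x / ε, v)) (ε⁻¹ * y) := by
    funext y; simp [div_eq_inv_mul]
  have hsc : ContDiff ℝ n (fun y : ℝ => Θ (x / ε, y / ε)) := by
    rw [hcomp]; exact hsl.comp (contDiff_const.mul contDiff_id)
  rw [iteratedDeriv_const_mul _ hsc.contDiffAt, hcomp, iteratedDeriv_comp_const_smul hsl (ε⁻¹)]
  simp only [Complex.real_smul, div_eq_inv_mul]
  push_cast
  ring

/-- **Second differences by the mean value inequality, twice** ("a Taylor expansion of `𝒞̇_t(x,y)` to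
order `q` in `x`", `q = 2`): `‖ψ(x) - 2ψ(x-a) + ψ(x-2a)‖ ≤ a² sup‖ψ''‖`.
[cite: Salmhofer1998, Lemma 5 proof (p.20 L96–104)] -/
theorem norm_secondDiff_le {ψ : ℝ → ℂ} (hψ : ContDiff ℝ 2 ψ) {B : ℝ}
    (hB : ∀ x : ℝ, ‖iteratedDeriv 2 ψ x‖ ≤ B) (x a : ℝ) :
    ‖ψ x - 2 * ψ (x - a) + ψ (x - 2 * a)‖ ≤ a ^ 2 * B := by
  have hB0 : 0 ≤ B := (norm_nonneg _).trans (hB 0)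
  have hd : Differentiable ℝ ψ := hψ.differentiable (by norm_num)
  have hd1 : Differentiable ℝ (deriv ψ) := by
    have := hψ.differentiable_iteratedDeriv 1 (by norm_num)
    simpa [iteratedDeriv_one] using this
  have hd2 : ∀ s, deriv (deriv ψ) s = iteratedDeriv 2 ψ s := by
    intro s
    have : iteratedDeriv 2 ψ = deriv (iteratedDeriv 1 ψ) := iteratedDeriv_succ
    rw [this, iteratedDeriv_one]
  -- first application: `‖ψ'(s) - ψ'(s - a)‖ ≤ B |a|`
  have step1 : ∀ s : ℝ, ‖deriv ψ s - deriv ψ (s - a)‖ ≤ B * |a| := by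
    intro s
    have h := Convex.norm_image_sub_le_of_norm_deriv_le (f := deriv ψ) (s := Set.univ)
      (fun y _ => hd1 y) (fun y _ => by rw [hd2]; exact hB y) convex_univ (Set.mem_univ (s - a))
      (Set.mem_univ s)
    have : ‖s - (s - a)‖ = |a| := by simp
    rw [this] at h
    exact h
  -- the auxiliary function `F(s) = ψ(s) - ψ(s - a)`
  set F : ℝ → ℂ := fun s => ψ s - ψ (s - a) with hF
  have hFd : ∀ s, HasDerivAt F (deriv ψ s - deriv ψ (s - a)) s := by
    intro s
    have h1 : HasDerivAt ψ (deriv ψ s) s := (hd s).hasDerivAt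
    have h2 : HasDerivAt (fun s : ℝ => ψ (s - a)) (deriv ψ (s - a)) s :=
      HasDerivAt.comp_sub_const s a (hd (s - a)).hasDerivAt
    exact h1.sub h2
  have step2 : ‖F x - F (x - a)‖ ≤ B * |a| * ‖x - (x - a)‖ :=
    Convex.norm_image_sub_le_of_norm_deriv_le (f := F) (s := Set.univ)
      (fun y _ => (hFd y).differentiableAt) (fun y _ => by rw [(hFd y).deriv]; exact step1 y)
      convex_univ (Set.mem_univ _) (Set.mem_univ _)
  have hn : ‖x - (x - a)‖ = |a| := by simp
  rw [hn] at step2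
  have hid : ψ x - 2 * ψ (x - a) + ψ (x - 2 * a) = F x - F (x - a) := by
    simp only [hF]; ring_nf
  rw [hid]
  calc ‖F x - F (x - a)‖ ≤ B * |a| * |a| := step2
    _ = a ^ 2 * B := by rw [mul_assoc, ← sq, sq_abs]; ring

end Profile

/-! ### One-variable scaling -/

/-- Scaling in one variable: `(d/dw)ⁿ [c φ(w/ε)] = c ε⁻ⁿ φ⁽ⁿ⁾(w/ε)`.
[cite: Salmhofer1998, Lemma 4 (5.18) (p.19 L138–141); Lemma 5 proof (5.25) (p.20 L99–104)] -/
theorem iteratedDeriv_const_mul_comp_div {φ : ℝ → ℂ} {n : ℕ} (hφ : ContDiff ℝ n φ) (c : ℂ) (ε w : ℝ) :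
    iteratedDeriv n (fun y : ℝ => c * φ (y / ε)) w =
      c * (((ε⁻¹) ^ n : ℝ) : ℂ) * iteratedDeriv n φ (w / ε) := by
  have hcomp : (fun y : ℝ => φ (y / ε)) = fun y : ℝ => φ (ε⁻¹ * y) := by
    funext y; simp [div_eq_inv_mul]
  have hsc : ContDiff ℝ n (fun y : ℝ => φ (y / ε)) := by
    rw [hcomp]; exact hφ.comp (contDiff_const.mul contDiff_id)
  rw [iteratedDeriv_const_mul _ hsc.contDiffAt, hcomp, iteratedDeriv_comp_const_smul hφ (ε⁻¹)]
  simp only [Complex.real_smul, div_eq_inv_mul]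
  push_cast
  ring

/-! ### The scaled slice family `y ↦ ε⁻¹ Θ(x/ε, y/ε)` -/

/-- The scaled slice `y ↦ ε⁻¹ Θ(x/ε, y/ε)` of a profile `Θ` (for `Θ = kerProfile χ₁`, `ε = ε_t` and
`x = ω_β(k₀)` this is `y ↦ 𝒞̇_t(x, y)`, `covCDot_eq_scaledSlice`). Proof device. [folklore] -/
def scaledSlice (Θ : ℝ × ℝ → ℂ) (ε x : ℝ) : ℝ → ℂ :=
  fun y => ((ε⁻¹ : ℝ) : ℂ) * Θ (x / ε, y / ε)

section Scaled

variable {Θ : ℝ × ℝ → ℂ}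

/-- Unfolding `scaledSlice`. [cite: Salmhofer1998, Lemma 5 proof (p.20 L80–82)] -/
theorem scaledSlice_apply (Θ : ℝ × ℝ → ℂ) (ε x y : ℝ) :
    scaledSlice Θ ε x y = ((ε⁻¹ : ℝ) : ℂ) * Θ (x / ε, y / ε) := rfl

/-- The scaled slice is smooth in `y`. [cite: Salmhofer1998, Lemma 5 proof (p.20 L99–101)] -/
theorem contDiff_scaledSlice (hΘ : ContDiff ℝ ∞ Θ) (ε x : ℝ) : ContDiff ℝ ∞ (scaledSlice Θ ε x) := by
  unfold scaledSlice
  have hsl : ContDiff ℝ ∞ (fun v : ℝ => Θ (x / ε, v)) := contDiff_slice_snd hΘ _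
  have hcomp : (fun y : ℝ => Θ (x / ε, y / ε)) = fun y : ℝ => (fun v : ℝ => Θ (x / ε, v)) (ε⁻¹ * y) := by
    funext y; simp [div_eq_inv_mul]
  have hsc : ContDiff ℝ ∞ (fun y : ℝ => Θ (x / ε, y / ε)) := by
    rw [hcomp]; exact hsl.comp (contDiff_const.mul contDiff_id)
  exact contDiff_const.mul hsc

/-- `n`-th derivative of the scaled slice: `ε^{-1-n} · ∂₂ⁿΘ(x/ε, y/ε)` written with the slice of `Θ`.
[cite: Salmhofer1998, Lemma 5 proof (5.25) (p.20 L99–104)] -/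
theorem iteratedDeriv_scaledSlice_eq (hΘ : ContDiff ℝ ∞ Θ) (ε x : ℝ) (n : ℕ) (y : ℝ) :
    iteratedDeriv n (scaledSlice Θ ε x) y =
      ((ε⁻¹ : ℝ) : ℂ) * (((ε⁻¹) ^ n : ℝ) : ℂ) * iteratedDeriv n (fun v : ℝ => Θ (x / ε, v)) (y / ε) := by
  unfold scaledSlice
  exact iteratedDeriv_const_mul_comp_div ((contDiff_slice_snd hΘ _).of_le (mod_cast le_top)) _ ε y

/-- `n`-th derivative of the scaled slice as an evaluated Fréchet derivative of the profile:
`ε^{-1-n} · DⁿΘ(x/ε, y/ε)[(0,1),…,(0,1)]`. [cite: Salmhofer1998, Lemma 5 proof (5.25) (p.20 L99–104)] -/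
theorem iteratedDeriv_scaledSlice_eq' (hΘ : ContDiff ℝ ∞ Θ) (ε x : ℝ) (n : ℕ) (y : ℝ) :
    iteratedDeriv n (scaledSlice Θ ε x) y =
      (((ε⁻¹) ^ (n + 1) : ℝ) : ℂ) *
        iteratedFDeriv ℝ n Θ (x / ε, y / ε) (fun _ => ((0 : ℝ), (1 : ℝ))) := by
  rw [iteratedDeriv_scaledSlice_eq hΘ, iteratedDeriv_slice_snd hΘ]
  push_cast
  ring

/-- **The `ε^{-1-n}` bound, uniformly in `x` and in `0 < ε ≤ 1`, for all orders `n ≤ K` at once**: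
`‖(d/dy)ⁿ [ε⁻¹Θ(x/ε, y/ε)]‖ ≤ C_K ε^{-1-n}` (the law `N₁ ε_t^{-1-|α|}` of (5.25) at `q = 0`, and
`B_α ε_t^{-1-|α|}` of (5.18)). [cite: Salmhofer1998, Lemma 5 proof (5.25) (p.20 L99–104); Lemma 4 (5.18) (p.19 L138–141)] -/
theorem exists_bound_iteratedDeriv_scaledSlice (hΘ : ContDiff ℝ ∞ Θ) (hc : HasCompactSupport Θ) (K : ℕ) :
    ∃ C : ℝ, 0 ≤ C ∧ ∀ ε : ℝ, 0 < ε → ∀ (x : ℝ) (n : ℕ), n ≤ K → ∀ y : ℝ,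
      ‖iteratedDeriv n (scaledSlice Θ ε x) y‖ ≤ C * (ε⁻¹) ^ (n + 1) := by
  choose C hC0 hC using fun n => exists_bound_slice_snd hΘ hc n
  refine ⟨∑ i ∈ Finset.range (K + 1), C i, Finset.sum_nonneg fun i _ => hC0 i, ?_⟩
  intro ε hε x n hn y
  have hCn : C n ≤ ∑ i ∈ Finset.range (K + 1), C i :=
    Finset.single_le_sum (fun i _ => hC0 i) (Finset.mem_range.mpr (Nat.lt_succ_of_le hn))
  rw [iteratedDeriv_scaledSlice_eq hΘ, norm_mul, norm_mul, Complex.norm_real, Complex.norm_real,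
    Real.norm_eq_abs, Real.norm_eq_abs, abs_of_pos (inv_pos.mpr hε), abs_of_pos (pow_pos (inv_pos.mpr hε) _)]
  calc ε⁻¹ * (ε⁻¹) ^ n * ‖iteratedDeriv n (fun v : ℝ => Θ (x / ε, v)) (y / ε)‖
      ≤ ε⁻¹ * (ε⁻¹) ^ n * C n := by gcongr; exact hC n _ _
    _ ≤ ε⁻¹ * (ε⁻¹) ^ n * ∑ i ∈ Finset.range (K + 1), C i := by gcongr
    _ = (∑ i ∈ Finset.range (K + 1), C i) * (ε⁻¹) ^ (n + 1) := by ring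

/-- **The second-difference bound, all orders `n ≤ K` at once**: for the function
`x ↦ (d/dy)ⁿ[ε⁻¹Θ(x/ε, y/ε)]`, `‖Δ²_a(·)(x)‖ ≤ C_K a² ε^{-3-n}` uniformly in `x, y` and `ε > 0` (the law
`N₁ β^{-2} ε_t^{-1-|α|-q}`, `q = 2`, `a = 2π/β`, of (5.25)). [cite: Salmhofer1998, Lemma 5 proof (5.25) (p.20 L96–104)] -/
theorem exists_bound_secondDiff_iteratedDeriv_scaledSlice (hΘ : ContDiff ℝ ∞ Θ)
    (hc : HasCompactSupport Θ) (K : ℕ) :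
    ∃ C : ℝ, 0 ≤ C ∧ ∀ ε : ℝ, 0 < ε → ∀ (x a : ℝ) (n : ℕ), n ≤ K → ∀ y : ℝ,
      ‖iteratedDeriv n (scaledSlice Θ ε x) y - 2 * iteratedDeriv n (scaledSlice Θ ε (x - a)) y +
          iteratedDeriv n (scaledSlice Θ ε (x - 2 * a)) y‖ ≤ C * a ^ 2 * (ε⁻¹) ^ (n + 3) := by
  -- the profiles `Ψ_n(p) = DⁿΘ(p)[(0,1),…,(0,1)]` and the bounds of their `u`-slices' second derivatives
  set Ψ : ℕ → ℝ × ℝ → ℂ := fun n p => iteratedFDeriv ℝ n Θ p (fun _ => ((0 : ℝ), (1 : ℝ))) with hΨ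
  have hΨs : ∀ n, ContDiff ℝ ∞ (Ψ n) := fun n => contDiff_iteratedFDeriv_apply hΘ n _
  have hΨc : ∀ n, HasCompactSupport (Ψ n) := fun n => hasCompactSupport_iteratedFDeriv_apply hc n _
  choose C hC0 hC using fun n => exists_bound_slice_fst (hΨs n) (hΨc n) 2
  refine ⟨∑ i ∈ Finset.range (K + 1), C i, Finset.sum_nonneg fun i _ => hC0 i, ?_⟩
  intro ε hε x a n hn y
  have hCn : C n ≤ ∑ i ∈ Finset.range (K + 1), C i :=
    Finset.single_le_sum (fun i _ => hC0 i) (Finset.mem_range.mpr (Nat.lt_succ_of_le hn))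
  -- `φ(x') = (d/dy)ⁿ[scaledSlice Θ ε x'](y) = ε^{-(n+1)} Ψ_n(x'/ε, y/ε)`
  set c : ℂ := (((ε⁻¹) ^ (n + 1) : ℝ) : ℂ) with hcdef
  set φ : ℝ → ℂ := fun x' => c * (fun u : ℝ => Ψ n (u, y / ε)) (x' / ε) with hφdef
  have hφ : ∀ x', iteratedDeriv n (scaledSlice Θ ε x') y = φ x' := by
    intro x'
    rw [iteratedDeriv_scaledSlice_eq' hΘ]
  have hsl : ContDiff ℝ ∞ (fun u : ℝ => Ψ n (u, y / ε)) := contDiff_slice_fst (hΨs n) _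
  have hφ2 : ContDiff ℝ 2 φ := by
    have hcomp : (fun x' : ℝ => (fun u : ℝ => Ψ n (u, y / ε)) (x' / ε)) =
        fun x' : ℝ => (fun u : ℝ => Ψ n (u, y / ε)) (ε⁻¹ * x') := by
      funext x'; simp [div_eq_inv_mul]
    have h1 : ContDiff ℝ 2 (fun x' : ℝ => (fun u : ℝ => Ψ n (u, y / ε)) (x' / ε)) := by
      rw [hcomp]; exact (contDiff_infty.mp hsl 2).comp (contDiff_const.mul contDiff_id)
    exact contDiff_const.mul h1
  have hB : ∀ x', ‖iteratedDeriv 2 φ x'‖ ≤ (ε⁻¹) ^ (n + 1) * (ε⁻¹) ^ 2 * C n := by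
    intro x'
    rw [hφdef, iteratedDeriv_const_mul_comp_div (contDiff_infty.mp hsl 2) c ε x', norm_mul,
      norm_mul, hcdef, Complex.norm_real, Complex.norm_real, Real.norm_eq_abs, Real.norm_eq_abs,
      abs_of_pos (pow_pos (inv_pos.mpr hε) _), abs_of_pos (pow_pos (inv_pos.mpr hε) _)]
    gcongr
    exact hC n _ _
  have hmain := norm_secondDiff_le hφ2 hB x a
  rw [hφ, hφ, hφ]
  refine hmain.trans ?_
  have hεi : 0 < ε⁻¹ := inv_pos.mpr hε
  calc a ^ 2 * ((ε⁻¹) ^ (n + 1) * (ε⁻¹) ^ 2 * C n)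
      ≤ a ^ 2 * ((ε⁻¹) ^ (n + 1) * (ε⁻¹) ^ 2 * ∑ i ∈ Finset.range (K + 1), C i) := by gcongr
    _ = (∑ i ∈ Finset.range (K + 1), C i) * a ^ 2 * (ε⁻¹) ^ (n + 3) := by ring

/-- Support: if `Θ` vanishes outside the closed unit disc then `ε⁻¹Θ(x/ε, y/ε) = 0` as soon as
`x² + y² > ε²` ("for `𝒞_t(p)` to be nonzero, `|ω_β(p₀)| ≤ ε_t` must hold"; likewise `|E| ≤ ε_t`).
[cite: Salmhofer1998, Lemma 4 proof (p.20 L2–3); Lemma 5 proof (5.25) (p.20 L101–104)] -/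
theorem scaledSlice_eq_zero (hz : ∀ p : ℝ × ℝ, 1 < p.1 ^ 2 + p.2 ^ 2 → Θ p = 0) {ε : ℝ} (hε : 0 < ε)
    {x y : ℝ} (h : ε ^ 2 < x ^ 2 + y ^ 2) : scaledSlice Θ ε x y = 0 := by
  unfold scaledSlice
  rw [hz _ ?_, mul_zero]
  simp only [div_pow]
  rw [← add_div, lt_div_iff₀ (pow_pos hε 2)]
  linarith

/-- Support in `y` alone: `ε⁻¹Θ(x/ε, y/ε) = 0` if `|y| > ε`. [cite: Salmhofer1998, Lemma 4 (5.18) second line (p.19 L142–145)] -/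
theorem scaledSlice_eq_zero_of_lt_abs (hz : ∀ p : ℝ × ℝ, 1 < p.1 ^ 2 + p.2 ^ 2 → Θ p = 0) {ε : ℝ}
    (hε : 0 < ε) (x : ℝ) {y : ℝ} (h : ε < |y|) : scaledSlice Θ ε x y = 0 := by
  apply scaledSlice_eq_zero hz hε
  have h1 : ε ^ 2 < y ^ 2 := by
    calc ε ^ 2 < |y| ^ 2 := by gcongr
      _ = y ^ 2 := sq_abs y
  nlinarith [sq_nonneg x]

/-- Support in `x` alone: `ε⁻¹Θ(x/ε, ·) ≡ 0` if `|x| > ε`. [cite: Salmhofer1998, Lemma 4 proof (p.20 L2–3)] -/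
theorem scaledSlice_eq_zero_of_lt_abs' (hz : ∀ p : ℝ × ℝ, 1 < p.1 ^ 2 + p.2 ^ 2 → Θ p = 0) {ε : ℝ}
    (hε : 0 < ε) {x : ℝ} (h : ε < |x|) (y : ℝ) : scaledSlice Θ ε x y = 0 := by
  apply scaledSlice_eq_zero hz hε
  have h1 : ε ^ 2 < x ^ 2 := by
    calc ε ^ 2 < |x| ^ 2 := by gcongr
      _ = x ^ 2 := sq_abs x
  nlinarith [sq_nonneg y]

/-- Iterated derivatives of the second-difference combination `g₁ - 2g₂ + g₃` of smooth functions.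
[cite: Salmhofer1998, Lemma 5 proof (p.20 L96–101)] -/
theorem iteratedDeriv_secondDiff_comb {g₁ g₂ g₃ : ℝ → ℂ} (h₁ : ContDiff ℝ ∞ g₁) (h₂ : ContDiff ℝ ∞ g₂)
    (h₃ : ContDiff ℝ ∞ g₃) (n : ℕ) (y : ℝ) :
    iteratedDeriv n (fun y => g₁ y - 2 * g₂ y + g₃ y) y =
      iteratedDeriv n g₁ y - 2 * iteratedDeriv n g₂ y + iteratedDeriv n g₃ y := by
  have h₁' : ContDiffAt ℝ n g₁ y := (h₁.of_le (mod_cast le_top)).contDiffAt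
  have h₂' : ContDiffAt ℝ n g₂ y := (h₂.of_le (mod_cast le_top)).contDiffAt
  have h₃' : ContDiffAt ℝ n g₃ y := (h₃.of_le (mod_cast le_top)).contDiffAt
  have h2g : ContDiffAt ℝ n (fun y => 2 * g₂ y) y := contDiffAt_const.mul h₂'
  have h12 : ContDiffAt ℝ n (fun y => g₁ y - 2 * g₂ y) y := h₁'.sub h2g
  have e1 : iteratedDeriv n (fun y => g₁ y - 2 * g₂ y + g₃ y) y =
      iteratedDeriv n (fun y => g₁ y - 2 * g₂ y) y + iteratedDeriv n g₃ y :=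
    iteratedDeriv_add h12 h₃'
  have e2 : iteratedDeriv n (fun y => g₁ y - 2 * g₂ y) y =
      iteratedDeriv n g₁ y - iteratedDeriv n (fun y => 2 * g₂ y) y :=
    iteratedDeriv_sub h₁' h2g
  have e3 : iteratedDeriv n (fun y => 2 * g₂ y) y = 2 * iteratedDeriv n g₂ y :=
    iteratedDeriv_const_mul _ h₂'
  rw [e1, e2, e3]

/-- The second-difference combination of scaled slices is smooth in `y`.
[cite: Salmhofer1998, Lemma 5 proof (p.20 L99–101)] -/
theorem contDiff_scaledSlice_secondDiff (hΘ : ContDiff ℝ ∞ Θ) (ε x a : ℝ) :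
    ContDiff ℝ ∞ fun y : ℝ =>
      scaledSlice Θ ε x y - 2 * scaledSlice Θ ε (x - a) y + scaledSlice Θ ε (x - 2 * a) y :=
  ((contDiff_scaledSlice hΘ ε x).sub (contDiff_const.mul (contDiff_scaledSlice hΘ ε _))).add
    (contDiff_scaledSlice hΘ ε _)

/-- Iterated `y`-derivatives of the second-difference combination of scaled slices, termwise.
[cite: Salmhofer1998, Lemma 5 proof (p.20 L96–101)] -/
theorem iteratedDeriv_scaledSlice_secondDiff (hΘ : ContDiff ℝ ∞ Θ) (ε x a : ℝ) (n : ℕ) (y : ℝ) :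
    iteratedDeriv n (fun y : ℝ =>
        scaledSlice Θ ε x y - 2 * scaledSlice Θ ε (x - a) y + scaledSlice Θ ε (x - 2 * a) y) y =
      iteratedDeriv n (scaledSlice Θ ε x) y - 2 * iteratedDeriv n (scaledSlice Θ ε (x - a)) y +
        iteratedDeriv n (scaledSlice Θ ε (x - 2 * a)) y :=
  iteratedDeriv_secondDiff_comb (contDiff_scaledSlice hΘ ε x) (contDiff_scaledSlice hΘ ε _)
    (contDiff_scaledSlice hΘ ε _) n y

end Scaled

/-! ### The cutoff `χ₁` extended to a global `C^∞` function, and the profile of `𝒞̇_t` -/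

/-- The global smooth modification `χ̃` of the cutoff: `χ̃ = 1` on `(-∞, 1/8]`, `χ̃ = χ₁` on `(1/8, ∞)`;
since `χ₁ = 1` on `[0, 1/4]`, `χ̃ = χ₁` on `[0, ∞)` and `χ̃ ∈ C^∞(ℝ)`.  Proof device (the paper's
`χ₁ ∈ C^∞(ℝ₀⁺,[0,1])` is only ever evaluated at nonnegative arguments). [folklore] -/
def cutoffExt (χ₁ : ℝ → ℝ) (r : ℝ) : ℝ := if r ≤ 1 / 8 then 1 else χ₁ r

section Cutoff

variable {χ₁ : ℝ → ℝ}

/-- `χ̃ = 1` on `(-∞, 1/4)`. [cite: Salmhofer1998, §4.1 (p.15 L125–134)] -/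
theorem cutoffExt_eq_one (hχ : IsCutoff χ₁) {r : ℝ} (hr : r < 1 / 4) : cutoffExt χ₁ r = 1 := by
  unfold cutoffExt
  split_ifs with h
  · rfl
  · push Not at h
    exact hχ.eq_one r (by linarith) hr.le

/-- `χ̃ = χ₁` on `[0, ∞)`. [cite: Salmhofer1998, §4.1 (p.15 L125–134)] -/
theorem cutoffExt_eq (hχ : IsCutoff χ₁) {r : ℝ} (hr : 0 ≤ r) : cutoffExt χ₁ r = χ₁ r := by
  unfold cutoffExt
  split_ifs with h
  · exact (hχ.eq_one r hr (by linarith)).symm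
  · rfl

/-- `χ̃ = 0` on `[1, ∞)`. [cite: Salmhofer1998, §4.1 (p.15 L125–134)] -/
theorem cutoffExt_eq_zero (hχ : IsCutoff χ₁) {r : ℝ} (hr : 1 ≤ r) : cutoffExt χ₁ r = 0 := by
  rw [cutoffExt_eq hχ (by linarith)]
  exact hχ.eq_zero r hr

/-- `χ̃ ∈ C^∞(ℝ)`. [cite: Salmhofer1998, §4.1 (p.15 L125–134)] -/
theorem contDiff_cutoffExt (hχ : IsCutoff χ₁) : ContDiff ℝ ∞ (cutoffExt χ₁) := by
  rw [contDiff_iff_contDiffAt]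
  intro r
  rcases lt_or_ge r (1 / 4) with hr | hr
  · -- near `r`, `χ̃ ≡ 1`
    have hev : cutoffExt χ₁ =ᶠ[𝓝 r] fun _ => (1 : ℝ) := by
      filter_upwards [Iio_mem_nhds hr] with s hs
      exact cutoffExt_eq_one hχ hs
    exact (contDiffAt_const (c := (1 : ℝ))).congr_of_eventuallyEq hev
  · -- near `r`, `χ̃ ≡ χ₁`, which is smooth on the neighbourhood `[0,∞)` of `r > 0`
    have hr0 : 0 < r := by linarith
    have hev : cutoffExt χ₁ =ᶠ[𝓝 r] χ₁ := by
      filter_upwards [Ioi_mem_nhds hr0] with s hs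
      exact cutoffExt_eq hχ (le_of_lt hs)
    have hχat : ContDiffAt ℝ ∞ χ₁ r := hχ.smooth.contDiffAt (Ici_mem_nhds hr0)
    exact hχat.congr_of_eventuallyEq hev

/-- `χ̃' = χ₁'` on `(0, ∞)`. [cite: Salmhofer1998, §4.1 (p.15 L125–134)] -/
theorem deriv_cutoffExt_eq (hχ : IsCutoff χ₁) {r : ℝ} (hr : 0 < r) :
    deriv (cutoffExt χ₁) r = deriv χ₁ r := by
  have hev : cutoffExt χ₁ =ᶠ[𝓝 r] χ₁ := by
    filter_upwards [Ioi_mem_nhds hr] with s hs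
    exact cutoffExt_eq hχ (le_of_lt hs)
  exact hev.deriv_eq

/-- `χ̃' = 0` on `(1, ∞)`. [cite: Salmhofer1998, §4.1 (p.15 L125–134); Proposition 4 proof (p.18 L88–89)] -/
theorem deriv_cutoffExt_eq_zero_of_one_lt (hχ : IsCutoff χ₁) {r : ℝ} (hr : 1 < r) :
    deriv (cutoffExt χ₁) r = 0 := by
  rw [deriv_cutoffExt_eq hχ (by linarith)]
  exact hχ.deriv_eq_zero_of_one_lt hr

/-- `χ̃'` is smooth. [cite: Salmhofer1998, §4.1 (p.15 L125–134)] -/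
theorem contDiff_deriv_cutoffExt (hχ : IsCutoff χ₁) : ContDiff ℝ ∞ (deriv (cutoffExt χ₁)) := by
  have := (contDiff_cutoffExt hχ).iterate_deriv 1
  simpa using this

end Cutoff

/-- **The profile of `𝒞̇_t`**: `Φ(u,v) = -2(iu + v) χ₁'(u² + v²)` (with the smooth extension `χ̃` of
`χ₁`), so that `𝒞̇_t(x,y) = ε_t⁻¹ Φ(x/ε_t, y/ε_t)` ("`𝒞̇_t(ω,E) = -(2/ε_t²)(iω + E) χ₁'((ω² + E²)/ε_t²)`").
Proof device. [folklore] -/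
def kerProfile (χ₁ : ℝ → ℝ) : ℝ × ℝ → ℂ :=
  fun p => -2 * (Complex.I * (p.1 : ℂ) + (p.2 : ℂ)) * ((deriv (cutoffExt χ₁) (p.1 ^ 2 + p.2 ^ 2) : ℝ) : ℂ)

section Kernel

variable {χ₁ : ℝ → ℝ}

/-- The profile is smooth on `ℝ × ℝ`. [cite: Salmhofer1998, Lemma 5 proof (p.20 L99–101)] -/
theorem contDiff_kerProfile (hχ : IsCutoff χ₁) : ContDiff ℝ ∞ (kerProfile χ₁) := by
  unfold kerProfile
  have h1 : ContDiff ℝ ∞ fun p : ℝ × ℝ => (p.1 : ℂ) := Complex.ofRealCLM.contDiff.comp contDiff_fst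
  have h2 : ContDiff ℝ ∞ fun p : ℝ × ℝ => (p.2 : ℂ) := Complex.ofRealCLM.contDiff.comp contDiff_snd
  have h3 : ContDiff ℝ ∞ fun p : ℝ × ℝ => p.1 ^ 2 + p.2 ^ 2 :=
    (contDiff_fst.pow 2).add (contDiff_snd.pow 2)
  have h4 : ContDiff ℝ ∞ fun p : ℝ × ℝ => ((deriv (cutoffExt χ₁) (p.1 ^ 2 + p.2 ^ 2) : ℝ) : ℂ) :=
    Complex.ofRealCLM.contDiff.comp ((contDiff_deriv_cutoffExt hχ).comp h3)
  exact (contDiff_const.mul ((contDiff_const.mul h1).add h2)).mul h4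

/-- The profile vanishes outside the closed unit disc (`χ₁' = 0` on `(1,∞)`).
[cite: Salmhofer1998, Lemma 4 proof (p.20 L2–3)] -/
theorem kerProfile_eq_zero (hχ : IsCutoff χ₁) (p : ℝ × ℝ) (hp : 1 < p.1 ^ 2 + p.2 ^ 2) :
    kerProfile χ₁ p = 0 := by
  unfold kerProfile
  rw [deriv_cutoffExt_eq_zero_of_one_lt hχ hp]
  simp

/-- The profile is compactly supported (support in the closed unit disc, inside the closed unit ball
of the sup norm). [cite: Salmhofer1998, Lemma 4 proof (p.20 L2–3)] -/
theorem hasCompactSupport_kerProfile (hχ : IsCutoff χ₁) : HasCompactSupport (kerProfile χ₁) := by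
  refine HasCompactSupport.intro (isCompact_closedBall (0 : ℝ × ℝ) 1) ?_
  intro p hp
  apply kerProfile_eq_zero hχ
  rw [Metric.mem_closedBall, dist_zero_right, Prod.norm_def] at hp
  push Not at hp
  rcases lt_max_iff.mp hp with h | h
  · rw [Real.norm_eq_abs] at h
    have : 1 < p.1 ^ 2 := by
      calc (1 : ℝ) = 1 ^ 2 := by norm_num
        _ < |p.1| ^ 2 := by gcongr
        _ = p.1 ^ 2 := sq_abs _
    nlinarith [sq_nonneg p.2]
  · rw [Real.norm_eq_abs] at h
    have : 1 < p.2 ^ 2 := by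
      calc (1 : ℝ) = 1 ^ 2 := by norm_num
        _ < |p.2| ^ 2 := by gcongr
        _ = p.2 ^ 2 := sq_abs _
    nlinarith [sq_nonneg p.1]

/-- **`𝒞̇_t(x,y) = ε_t⁻¹ Φ(x/ε_t, y/ε_t)`**, i.e. `covCDot χ₁ ε₀ t x = scaledSlice (kerProfile χ₁) ε_t x`
(the printed formula `𝒞̇_t(x,y) = -(2/ε_t²)(ix + y)χ₁'((x² + y²)/ε_t²)`, rescaled).
[cite: Salmhofer1998, Lemma 5 proof (p.20 L80–82)] -/
theorem covCDot_eq_scaledSlice (hχ : IsCutoff χ₁) {eps0 : ℝ} (h0 : 0 < eps0) (t x y : ℝ) :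
    covCDot χ₁ eps0 t x y = scaledSlice (kerProfile χ₁) (epsT eps0 t) x y := by
  rw [covCDot_eq hχ h0, scaledSlice_apply]
  unfold kerProfile
  have hε := epsT_pos h0 t
  set ε := epsT eps0 t with hεdef
  have harg : (x / ε) ^ 2 + (y / ε) ^ 2 = (x ^ 2 + y ^ 2) / ε ^ 2 := by
    field_simp
  simp only [harg]
  rcases (add_nonneg (sq_nonneg x) (sq_nonneg y)).eq_or_lt with hxy | hxy
  · -- `x = y = 0`: both sides vanish
    have hx : x = 0 := by nlinarith [sq_nonneg x, sq_nonneg y]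
    have hy : y = 0 := by nlinarith [sq_nonneg x, sq_nonneg y]
    subst hx; subst hy
    simp
  · rw [deriv_cutoffExt_eq hχ (div_pos hxy (pow_pos hε 2))]
    have hεne : (ε : ℂ) ≠ 0 := by exact_mod_cast hε.ne'
    push_cast
    field_simp

/-- `𝒞̇_t(x,y)` is a smooth function of `y`. [cite: Salmhofer1998, Lemma 5 proof (p.20 L99–101)] -/
theorem contDiff_covCDot (hχ : IsCutoff χ₁) {eps0 : ℝ} (h0 : 0 < eps0) (t x : ℝ) :
    ContDiff ℝ ∞ fun y : ℝ => covCDot χ₁ eps0 t x y := by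
  have : (fun y : ℝ => covCDot χ₁ eps0 t x y) = scaledSlice (kerProfile χ₁) (epsT eps0 t) x := by
    funext y; exact covCDot_eq_scaledSlice hχ h0 t x y
  rw [this]
  exact contDiff_scaledSlice (contDiff_kerProfile hχ) _ _

end Kernel


end Salmhofer1998

end Literature.MathematicalPhysics.QuantumLattice.FermiRG
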